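import Summits.CriticalPhenomena.PercolationContinuityZ3.Theorems.PercNearOneGluingNoHeavyLowerTailSunflowerOrPetal
import HarnessLib

/-!
# `NoHeavyLowerTail` (crux stmt-CriticalPhenomena-4575), abstract sunflower cubic: (R2) for three up-sets one of which is a DISJUNCTION

Support file (seat `prim-ineq-gen-2` gen 22; `--supports stmt-CriticalPhenomena-4575`).  No `sorry`, no new definitions.
Memo: run/shared/lean/prim/prim-ineq-gen-2/SPECTATOR-TRANSFER-GEN22.md §7.

The θ-pullback form of `…SunflowerOrPetal`: for ARBITRARY up-sets `U j`, `U k` and the disjunction `U i = OR_{S₀} = {S : S ∩ S₀ ≠ ∅}` (`S₀ ≠ ∅`),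
the `H`-row partition functional of the θ-pullback sunflower `ofUpsets U` (kernel = "in at least two", petal `i` = "in `U i` only") is nonnegative:
`ZH_ofUpsets_nonneg_of_or`.  Companion of `ZH_ofUpsets_nonneg_of_centered` (`…SunflowerCenteredPetal`) and `ZH_ofUpsets_nonneg_of_crossIntersecting`.
-/

namespace Summit.CriticalPhenomena.PercolationContinuityZ3.Theorems.SunflowerPartition

open Finset

variable {α : Type*} [Fintype α] [DecidableEq α]

/-- **(R2) for three up-sets one of which is the disjunction `OR_{S₀}`** (`S ∈ U i ↔ S ∩ S₀ ≠ ∅`, `S₀` nonempty; the other two up-sets arbitrary):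
`0 ≤ ZH (ofUpsets U)`. [this work] -/
theorem ZH_ofUpsets_nonneg_of_or (U : Fin 3 → Finset (Finset α)) (hU : ∀ i, IsUpperSet (U i : Set (Finset α))) (i : Fin 3)
    (S₀ : Finset α) (hne : S₀.Nonempty) (hUi : ∀ S : Finset α, S ∈ U i ↔ (S ∩ S₀).Nonempty) : 0 ≤ (ofUpsets U hU).ZH := by
  set F := ofUpsets U hU with hF
  have hV : ∀ S : Finset α, (S ∩ S₀).Nonempty → S ∈ F.V i := fun S hS => by
    show S ∈ U i ∪ twoOf U
    exact mem_union_left _ ((hUi S).2 hS)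
  have hback : ∀ S : Finset α, S ∈ F.V i → S ∉ F.A → (S ∩ S₀).Nonempty := fun S hS hA =>
    (hUi S).1 (mem_U_of_mem_ofUpsets_V hU hS hA)
  fin_cases i
  · refine F.ZH_nonneg_of_orPetal_label 1 (Or.inl rfl) hne (fun S hS => (F.lab_V0_iff S).2 (hV S hS)) fun S hS => ?_
    have hSV : S ∈ F.V 0 := (F.lab_V0_iff S).1 (Or.inl hS)
    exact hback S hSV fun hA => by have := (F.lab_eq_four_iff S).2 hA; omega
  · refine F.ZH_nonneg_of_orPetal_label 2 (Or.inr (Or.inl rfl)) hne (fun S hS => (F.lab_V1_iff S).2 (hV S hS)) fun S hS => ?_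
    have hSV : S ∈ F.V 1 := (F.lab_V1_iff S).1 (Or.inl hS)
    exact hback S hSV fun hA => by have := (F.lab_eq_four_iff S).2 hA; omega
  · refine F.ZH_nonneg_of_orPetal_label 3 (Or.inr (Or.inr rfl)) hne (fun S hS => (F.lab_V2_iff S).2 (hV S hS)) fun S hS => ?_
    have hSV : S ∈ F.V 2 := (F.lab_V2_iff S).1 (Or.inl hS)
    exact hback S hSV fun hA => by have := (F.lab_eq_four_iff S).2 hA; omega

end Summit.CriticalPhenomena.PercolationContinuityZ3.Theorems.SunflowerPartition
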